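import Literature.Analysis.FluidPDE.WholeSpaceIBP
import Literature.Analysis.FluidPDE.LeraySeparationOfEnergyTools
import Mathlib.Analysis.Calculus.ContDiff.Bounds
import Mathlib.MeasureTheory.Function.L2Space
import HarnessLib

/-!
# Whole-space interpolation between `L²` Sobolev norms of integer order (no compact support)

Analysis/FluidPDE support file (everything proved; no definitions, no named facts). For a `C²` field
`h : E → F'` on a finite-dimensional real inner product space `E` (Lebesgue measure) with values in a real
inner product space, whose slices `h`, `Dh`, `D²h` are square integrable — NO decay or compact support is
asked — the boundary-free Green identity `∫ |∇h|²_F = −∫ ⟪h, Δh⟫` holds (Mathlib's integration by parts for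
INTEGRABLE products, `integral_bilinear_fderiv_right_eq_neg_left_of_integrable`, in each coordinate
direction), whence the interpolation inequality between the orders `0, 1, 2`:

* `wholeSpace_integral_norm_sq_fderiv_apply_eq_neg` — `∫ ‖∂ᵥh‖² = −∫ ⟪h, ∂ᵥ∂ᵥh⟫` for one direction `v`;
* `wholeSpace_integral_frobeniusNormSq_fderiv_eq_neg_integral_inner_laplacian` — `∫ |∇h|²_F = −∫ ⟪h, Δh⟫`;
* `wholeSpace_integral_frobeniusNormSq_fderiv_le` — `∫ |∇h|²_F ≤ ‖h‖_{L²} ‖Δh‖_{L²}`;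
* `wholeSpace_integral_norm_fderiv_sq_le` — **`∫ ‖Dh‖² ≤ d · ‖h‖_{L²} ‖D²h‖_{L²}`** (`d = dim E`; operator norms,
  `‖Δh‖ ≤ d ‖D²h‖`), i.e. `‖Dh‖_{L²} ≤ √d ‖h‖_{L²}^{1/2} ‖D²h‖_{L²}^{1/2}` — the integer case of the
  Gagliardo–Nirenberg / Ehrling interpolation inequality on `ℝᵈ` (Adams–Fournier, Thm. 5.2 (3); the torus
  twin is the tree's `TorusLatticeNorms.latNormSq_interpolate`, the Fourier-side twin
  `Function.eHomSobolevSeminorm_interpolate`).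

These are the forms used by every «energy / enstrophy» a priori argument (cell `ns-claims`, D-0090, class
(GRON); e.g. C136 `PaiLimsuwan2026` (3.3), C17 `Chae2007` (1.10)) and the first rung of the whole-space
Gagliardo–Nirenberg inequality `‖∇h‖_∞ ≲ ‖h‖^{1/6}_{L²} ‖D³h‖^{5/6}_{L²}` on `ℝ³`.

## Mathlib / tree search

Mathlib: integration by parts on `ℝᵈ` for integrable products
(`integral_bilinear_fderiv_right_eq_neg_left_of_integrable`), `laplacian_eq_iteratedFDeriv_orthonormalBasis`,
no Sobolev interpolation. Tree: the compact-support Green identity `integral_inner_laplacian_add_eq_zero`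
(`WholeSpaceIBP.lean`), the Fourier-side `eHomSobolevSeminorm_interpolate` (`HomSobolevInterpolation.lean`),
torus versions (`TorusLatticeNorms`); nothing on the whole space in physical variables without compact support.

## References
* R. A. Adams, J. J. F. Fournier, *Sobolev Spaces*, 2nd ed. (2003), Thm. 5.2. [AdamsFournier2003]
* L. Nirenberg, Ann. Sc. Norm. Super. Pisa 13 (1959), Lecture II (the interpolation inequalities).
-/

noncomputable section

open MeasureTheory Set Function Filter Topology InnerProductSpace
open scoped RealInnerProductSpace ENNReal NNReal Laplacian

namespace Literature.Analysis.FluidPDE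

variable {E : Type*} [NormedAddCommGroup E] [InnerProductSpace ℝ E] [FiniteDimensional ℝ E]
  [MeasurableSpace E] [BorelSpace E]
variable {F' : Type*} [NormedAddCommGroup F'] [InnerProductSpace ℝ F']

/-! ### Pointwise facts -/

omit [FiniteDimensional ℝ E] [MeasurableSpace E] [BorelSpace E] in
/-- `‖∂ᵥ∂ᵥh(x)‖ ≤ ‖v‖² ‖D²h(x)‖`. [folklore] -/
private theorem norm_fderiv_fderiv_apply_le_norm_iteratedFDeriv_two {h : E → F'} (hh : ContDiff ℝ 2 h) (x v : E) :
    ‖fderiv ℝ (fun y => fderiv ℝ h y v) x v‖ ≤ ‖v‖ * ‖v‖ * ‖iteratedFDeriv ℝ 2 h x‖ := by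
  rw [fderiv_fderiv_apply_const hh x v]
  calc ‖iteratedFDeriv ℝ 2 h x ![v, v]‖
      ≤ ‖iteratedFDeriv ℝ 2 h x‖ * ∏ i, ‖(![v, v] : Fin 2 → E) i‖ :=
        ContinuousMultilinearMap.le_opNorm _ _
    _ = ‖v‖ * ‖v‖ * ‖iteratedFDeriv ℝ 2 h x‖ := by
        simp [Fin.prod_univ_two]; ring

omit [MeasurableSpace E] [BorelSpace E] in
/-- `‖Δh(x)‖ ≤ d ‖D²h(x)‖`, `d = dim E`. [folklore] -/
private theorem norm_laplacian_le_card_mul_norm_iteratedFDeriv_two {h : E → F'} (hh : ContDiff ℝ 2 h) (x : E) :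
    ‖(Δ h) x‖ ≤ Module.finrank ℝ E * ‖iteratedFDeriv ℝ 2 h x‖ := by
  set b := stdOrthonormalBasis ℝ E with hb
  rw [laplacian_eq_sum_fderiv_fderiv b hh x]
  calc ‖∑ i, fderiv ℝ (fun y => fderiv ℝ h y (b i)) x (b i)‖
      ≤ ∑ i, ‖fderiv ℝ (fun y => fderiv ℝ h y (b i)) x (b i)‖ := norm_sum_le _ _
    _ ≤ ∑ _i : Fin (Module.finrank ℝ E), ‖iteratedFDeriv ℝ 2 h x‖ :=
        Finset.sum_le_sum fun i _ => by
          have := norm_fderiv_fderiv_apply_le_norm_iteratedFDeriv_two hh x (b i)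
          rwa [b.norm_eq_one i, one_mul, one_mul] at this
    _ = Module.finrank ℝ E * ‖iteratedFDeriv ℝ 2 h x‖ := by
        simp [Finset.sum_const, Finset.card_univ, Fintype.card_fin]

omit [MeasurableSpace E] [BorelSpace E] in
/-- `|Dh(x)|²_F ≤ d ‖Dh(x)‖²`. [folklore] -/
private theorem frobeniusNormSq_le_finrank_mul (L : E →L[ℝ] F') :
    frobeniusNormSq L ≤ Module.finrank ℝ E * ‖L‖ ^ 2 := by
  set b := stdOrthonormalBasis ℝ E
  have h1 : ∀ i, ‖L (b i)‖ ^ 2 ≤ ‖L‖ ^ 2 := fun i => by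
    have := L.le_opNorm (b i)
    rw [b.norm_eq_one, mul_one] at this
    exact pow_le_pow_left₀ (norm_nonneg _) this 2
  calc frobeniusNormSq L = ∑ i, ‖L (b i)‖ ^ 2 := rfl
    _ ≤ ∑ _i : Fin (Module.finrank ℝ E), ‖L‖ ^ 2 := Finset.sum_le_sum fun i _ => h1 i
    _ = Module.finrank ℝ E * ‖L‖ ^ 2 := by
        simp [Finset.sum_const, Finset.card_univ, Fintype.card_fin]

omit [MeasurableSpace E] [BorelSpace E] in
/-- `x ↦ |∇h(x)|²_F` is continuous for a `C¹` field (finite sum of squared norms of partial derivatives).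
[folklore] -/
private theorem continuous_frobeniusNormSq_comp_fderiv {h : E → F'} (hh : ContDiff ℝ 1 h) :
    Continuous fun x => frobeniusNormSq (fderiv ℝ h x) := by
  unfold frobeniusNormSq
  exact continuous_finsetSum _ fun i _ =>
    (((hh.continuous_fderiv one_ne_zero).clm_apply continuous_const).norm.pow 2)

/-! ### Green's identity for square-integrable fields and their first two derivatives -/

/-- Products of `L²` functions paired by the inner product are integrable. (Plumbing.) [folklore] -/
private theorem integrable_inner_pair_of_memLp_two {f g : E → F'} (hf : MemLp f 2 volume) (hg : MemLp g 2 volume) :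
    Integrable (fun x => ⟪f x, g x⟫) volume := by
  refine (hf.norm.integrable_mul hg.norm).mono' (hf.1.inner hg.1) (Eventually.of_forall fun x => ?_)
  rw [Real.norm_eq_abs]
  simpa using abs_real_inner_le_norm (f x) (g x)

/-- **`∫ ‖∂ᵥh‖² = −∫ ⟪h, ∂ᵥ∂ᵥh⟫`** for a `C²` field with `h, ∂ᵥh, ∂ᵥ∂ᵥh ∈ L²` (integration by parts for
integrable products in the direction `v`; no boundary term, no compact support).
[cite: AdamsFournier2003, Thm. 5.2] -/
theorem wholeSpace_integral_norm_sq_fderiv_apply_eq_neg {h : E → F'} (hh : ContDiff ℝ 2 h) (v : E)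
    (h0 : MemLp h 2 volume) (h1 : MemLp (fun x => fderiv ℝ h x v) 2 volume)
    (h2 : MemLp (fun x => fderiv ℝ (fun y => fderiv ℝ h y v) x v) 2 volume) :
    ∫ x, ‖fderiv ℝ h x v‖ ^ 2 = - ∫ x, ⟪h x, fderiv ℝ (fun y => fderiv ℝ h y v) x v⟫ := by
  have hd1 : ContDiff ℝ 1 fun y => fderiv ℝ h y v :=
    (hh.fderiv_right (m := 1) le_rfl).clm_apply contDiff_const
  have key := integral_bilinear_fderiv_right_eq_neg_left_of_integrable (μ := volume)
    (f := h) (g := fun y => fderiv ℝ h y v) (v := v) (B := innerSL ℝ (E := F'))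
    ?_ ?_ ?_ (fun x _ => (hh.differentiable (by norm_num)) x)
    (fun x _ => (hd1.differentiable one_ne_zero) x)
  · simp only [innerSL_apply_apply (𝕜 := ℝ)] at key
    rw [key, neg_neg]
    exact integral_congr_ae (Eventually.of_forall fun x => (real_inner_self_eq_norm_sq _).symm)
  · simp only [innerSL_apply_apply (𝕜 := ℝ)]
    exact integrable_inner_pair_of_memLp_two h1 h1
  · simp only [innerSL_apply_apply (𝕜 := ℝ)]
    exact integrable_inner_pair_of_memLp_two h0 h2
  · simp only [innerSL_apply_apply (𝕜 := ℝ)]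
    exact integrable_inner_pair_of_memLp_two h0 h1

/-- The partial derivative `∂ᵢh = Dh(·)bᵢ` of a field with `Dh ∈ L²` is in `L²`. (Plumbing.) [folklore] -/
private theorem memLp_fderiv_apply_of_memLp {h : E → F'} (hh : ContDiff ℝ 1 h)
    (h1 : MemLp (fun x => fderiv ℝ h x) 2 volume) (v : E) :
    MemLp (fun x => fderiv ℝ h x v) 2 volume := by
  refine h1.of_le_mul (c := ‖v‖)
    (((hh.continuous_fderiv one_ne_zero).clm_apply continuous_const).aestronglyMeasurable)
    (Eventually.of_forall fun x => ?_)
  rw [mul_comm]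
  exact (fderiv ℝ h x).le_opNorm v

/-- The second partial `∂ᵥ∂ᵥh` of a field with `D²h ∈ L²` is in `L²`. (Plumbing.) [folklore] -/
private theorem memLp_fderiv_fderiv_apply_of_memLp {h : E → F'} (hh : ContDiff ℝ 2 h)
    (h2 : MemLp (fun x => iteratedFDeriv ℝ 2 h x) 2 volume) (v : E) :
    MemLp (fun x => fderiv ℝ (fun y => fderiv ℝ h y v) x v) 2 volume := by
  have hd1 : ContDiff ℝ 1 fun y => fderiv ℝ h y v :=
    (hh.fderiv_right (m := 1) le_rfl).clm_apply contDiff_const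
  refine h2.of_le_mul (c := ‖v‖ * ‖v‖)
    (((hd1.continuous_fderiv one_ne_zero).clm_apply continuous_const).aestronglyMeasurable)
    (Eventually.of_forall fun x => ?_)
  exact norm_fderiv_fderiv_apply_le_norm_iteratedFDeriv_two hh x v

/-- **Green's first identity on the whole space for `H²` fields**: for a `C²` field with `h, Dh, D²h ∈ L²`,
`∫ |∇h|²_F = −∫ ⟪h, Δh⟫` (sum of `wholeSpace_integral_norm_sq_fderiv_apply_eq_neg` over an orthonormal basis).
[cite: AdamsFournier2003, Thm. 5.2] -/
theorem wholeSpace_integral_frobeniusNormSq_fderiv_eq_neg_integral_inner_laplacian {h : E → F'} (hh : ContDiff ℝ 2 h)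
    (h0 : MemLp h 2 volume) (h1 : MemLp (fun x => fderiv ℝ h x) 2 volume)
    (h2 : MemLp (fun x => iteratedFDeriv ℝ 2 h x) 2 volume) :
    ∫ x, frobeniusNormSq (fderiv ℝ h x) = - ∫ x, ⟪h x, (Δ h) x⟫ := by
  set b := stdOrthonormalBasis ℝ E with hb
  have hmem1 : ∀ i, MemLp (fun x => fderiv ℝ h x (b i)) 2 volume := fun i =>
    memLp_fderiv_apply_of_memLp (hh.of_le one_le_two) h1 (b i)
  have hmem2 : ∀ i, MemLp (fun x => fderiv ℝ (fun y => fderiv ℝ h y (b i)) x (b i)) 2 volume := fun i =>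
    memLp_fderiv_fderiv_apply_of_memLp hh h2 (b i)
  have hint1 : ∀ i, Integrable (fun x => ‖fderiv ℝ h x (b i)‖ ^ 2) volume := fun i =>
    (memLp_two_iff_integrable_sq_norm (hmem1 i).1).1 (hmem1 i)
  have hint2 : ∀ i, Integrable (fun x => ⟪h x, fderiv ℝ (fun y => fderiv ℝ h y (b i)) x (b i)⟫) volume :=
    fun i => integrable_inner_pair_of_memLp_two h0 (hmem2 i)
  have e1 : ∫ x, frobeniusNormSq (fderiv ℝ h x) = ∑ i, ∫ x, ‖fderiv ℝ h x (b i)‖ ^ 2 := by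
    rw [← integral_finsetSum _ fun i _ => hint1 i]
    rfl
  have e3 : ∫ x, ∑ i, ⟪h x, fderiv ℝ (fun y => fderiv ℝ h y (b i)) x (b i)⟫ =
      ∑ i, ∫ x, ⟪h x, fderiv ℝ (fun y => fderiv ℝ h y (b i)) x (b i)⟫ :=
    integral_finsetSum _ fun i _ => hint2 i
  have e4 : ∫ x, ⟪h x, (Δ h) x⟫ = ∫ x, ∑ i, ⟪h x, fderiv ℝ (fun y => fderiv ℝ h y (b i)) x (b i)⟫ :=
    integral_congr_ae (Eventually.of_forall fun x => by
      simp only [laplacian_eq_sum_fderiv_fderiv b hh x, inner_sum])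
  rw [e1, e4, e3, ← Finset.sum_neg_distrib]
  exact Finset.sum_congr rfl fun i _ =>
    wholeSpace_integral_norm_sq_fderiv_apply_eq_neg hh (b i) h0 (hmem1 i) (hmem2 i)

/-- **`∫ |∇h|²_F ≤ ‖h‖_{L²} ‖Δh‖_{L²}`** (Green + Cauchy–Schwarz). [cite: AdamsFournier2003, Thm. 5.2] -/
theorem wholeSpace_integral_frobeniusNormSq_fderiv_le {h : E → F'} (hh : ContDiff ℝ 2 h)
    (h0 : MemLp h 2 volume) (h1 : MemLp (fun x => fderiv ℝ h x) 2 volume)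
    (h2 : MemLp (fun x => iteratedFDeriv ℝ 2 h x) 2 volume) :
    ∫ x, frobeniusNormSq (fderiv ℝ h x) ≤
      Real.sqrt (∫ x, ‖h x‖ ^ 2) * Real.sqrt (∫ x, ‖(Δ h) x‖ ^ 2) := by
  have hΔ : MemLp (fun x => (Δ h) x) 2 volume := by
    refine h2.of_le_mul (c := (Module.finrank ℝ E : ℝ)) (continuous_laplacian hh).aestronglyMeasurable
      (Eventually.of_forall fun x => ?_)
    exact norm_laplacian_le_card_mul_norm_iteratedFDeriv_two hh x
  rw [wholeSpace_integral_frobeniusNormSq_fderiv_eq_neg_integral_inner_laplacian hh h0 h1 h2]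
  have h0' : MemLp h (ENNReal.ofReal 2) volume := by rwa [ENNReal.ofReal_ofNat]
  have hΔ' : MemLp (fun x => (Δ h) x) (ENNReal.ofReal 2) volume := by rwa [ENNReal.ofReal_ofNat]
  have hcs := integral_mul_norm_le_Lp_mul_Lq (μ := volume) Real.HolderConjugate.two_two h0' hΔ'
  have e0 : ∫ x, ‖h x‖ ^ (2 : ℝ) = ∫ x, ‖h x‖ ^ 2 :=
    integral_congr_ae (Eventually.of_forall fun x => Real.rpow_two _)
  have e2 : ∫ x, ‖(Δ h) x‖ ^ (2 : ℝ) = ∫ x, ‖(Δ h) x‖ ^ 2 :=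
    integral_congr_ae (Eventually.of_forall fun x => Real.rpow_two _)
  rw [e0, e2, ← Real.sqrt_eq_rpow, ← Real.sqrt_eq_rpow] at hcs
  calc -∫ x, ⟪h x, (Δ h) x⟫ ≤ |∫ x, ⟪h x, (Δ h) x⟫| := neg_le_abs _
    _ ≤ ∫ x, |⟪h x, (Δ h) x⟫| := by
        rw [← Real.norm_eq_abs]; exact (norm_integral_le_integral_norm _).trans (le_of_eq (by simp))
    _ ≤ ∫ x, ‖h x‖ * ‖(Δ h) x‖ :=
        integral_mono_of_nonneg (Eventually.of_forall fun x => abs_nonneg _)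
          (h0.norm.integrable_mul hΔ.norm) (Eventually.of_forall fun x => abs_real_inner_le_norm _ _)
    _ ≤ Real.sqrt (∫ x, ‖h x‖ ^ 2) * Real.sqrt (∫ x, ‖(Δ h) x‖ ^ 2) := hcs

/-! ### First-order interpolation: `‖Dh‖²_{L²} ≤ d ‖h‖_{L²} ‖D²h‖_{L²}` -/

/-- **`∫ ‖Dh‖² ≤ d · ‖h‖_{L²} ‖D²h‖_{L²}`** (operator norms; `d = dim E`): for a `C²` field with
`h, Dh, D²h ∈ L²`. From `‖Dh‖² ≤ |∇h|²_F`, Green's identity and `‖Δh‖ ≤ d ‖D²h‖`.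
[cite: AdamsFournier2003, Thm. 5.2 (case m = 2, j = 1, p = 2)] -/
theorem wholeSpace_integral_norm_fderiv_sq_le {h : E → F'} (hh : ContDiff ℝ 2 h)
    (h0 : MemLp h 2 volume) (h1 : MemLp (fun x => fderiv ℝ h x) 2 volume)
    (h2 : MemLp (fun x => iteratedFDeriv ℝ 2 h x) 2 volume) :
    ∫ x, ‖fderiv ℝ h x‖ ^ 2 ≤
      Module.finrank ℝ E * (Real.sqrt (∫ x, ‖h x‖ ^ 2) * Real.sqrt (∫ x, ‖iteratedFDeriv ℝ 2 h x‖ ^ 2)) := by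
  set d : ℕ := Module.finrank ℝ E with hd
  have hi1 : Integrable (fun x => ‖fderiv ℝ h x‖ ^ 2) volume := (memLp_two_iff_integrable_sq_norm h1.1).1 h1
  have hi2 : Integrable (fun x => ‖iteratedFDeriv ℝ 2 h x‖ ^ 2) volume :=
    (memLp_two_iff_integrable_sq_norm h2.1).1 h2
  have hfrob : Integrable (fun x => frobeniusNormSq (fderiv ℝ h x)) volume := by
    refine (hi1.const_mul (d : ℝ)).mono'
      (continuous_frobeniusNormSq_comp_fderiv (hh.of_le (by norm_num))).aestronglyMeasurable
      (Eventually.of_forall fun x => ?_)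
    rw [Real.norm_eq_abs, abs_of_nonneg (frobeniusNormSq_nonneg _)]
    exact frobeniusNormSq_le_finrank_mul _
  have step1 : ∫ x, ‖fderiv ℝ h x‖ ^ 2 ≤ ∫ x, frobeniusNormSq (fderiv ℝ h x) :=
    integral_mono hi1 hfrob fun x => norm_sq_le_frobeniusNormSq _
  have step2 := wholeSpace_integral_frobeniusNormSq_fderiv_le hh h0 h1 h2
  have hiΔ : Integrable (fun x => ‖(Δ h) x‖ ^ 2) volume := by
    refine (hi2.const_mul ((d : ℝ) ^ 2)).mono' ((continuous_laplacian hh).norm.pow 2).aestronglyMeasurable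
      (Eventually.of_forall fun x => ?_)
    rw [Real.norm_eq_abs, abs_of_nonneg (sq_nonneg _), ← mul_pow]
    exact pow_le_pow_left₀ (norm_nonneg _) (norm_laplacian_le_card_mul_norm_iteratedFDeriv_two hh x) 2
  have step3 : Real.sqrt (∫ x, ‖(Δ h) x‖ ^ 2) ≤ d * Real.sqrt (∫ x, ‖iteratedFDeriv ℝ 2 h x‖ ^ 2) := by
    have hle : ∫ x, ‖(Δ h) x‖ ^ 2 ≤ (d : ℝ) ^ 2 * ∫ x, ‖iteratedFDeriv ℝ 2 h x‖ ^ 2 := by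
      rw [← integral_const_mul]
      refine integral_mono hiΔ (hi2.const_mul _) fun x => ?_
      rw [← mul_pow]
      exact pow_le_pow_left₀ (norm_nonneg _) (norm_laplacian_le_card_mul_norm_iteratedFDeriv_two hh x) 2
    calc Real.sqrt (∫ x, ‖(Δ h) x‖ ^ 2) ≤ Real.sqrt ((d : ℝ) ^ 2 * ∫ x, ‖iteratedFDeriv ℝ 2 h x‖ ^ 2) :=
          Real.sqrt_le_sqrt hle
      _ = d * Real.sqrt (∫ x, ‖iteratedFDeriv ℝ 2 h x‖ ^ 2) := by
          rw [Real.sqrt_mul (sq_nonneg _), Real.sqrt_sq (by positivity)]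
  have h0s : 0 ≤ Real.sqrt (∫ x, ‖h x‖ ^ 2) := Real.sqrt_nonneg _
  calc ∫ x, ‖fderiv ℝ h x‖ ^ 2 ≤ Real.sqrt (∫ x, ‖h x‖ ^ 2) * Real.sqrt (∫ x, ‖(Δ h) x‖ ^ 2) :=
        step1.trans step2
    _ ≤ Real.sqrt (∫ x, ‖h x‖ ^ 2) * (d * Real.sqrt (∫ x, ‖iteratedFDeriv ℝ 2 h x‖ ^ 2)) :=
        mul_le_mul_of_nonneg_left step3 h0s
    _ = d * (Real.sqrt (∫ x, ‖h x‖ ^ 2) * Real.sqrt (∫ x, ‖iteratedFDeriv ℝ 2 h x‖ ^ 2)) := by ring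

/-! ### Second-order interpolation: `‖D²h‖²_{L²} ≤ d² ‖Dh‖_{L²} ‖D³h‖_{L²}` -/

omit [MeasurableSpace E] [BorelSpace E] in
/-- `‖D²h(x)‖² ≤ Σⱼ ‖D(∂ⱼh)(x)‖²` over an orthonormal basis (Cauchy–Schwarz in the second slot).
[folklore] -/
private theorem norm_iteratedFDeriv_two_sq_le_sum {h : E → F'} (hh : ContDiff ℝ 2 h) (x : E) :
    ‖iteratedFDeriv ℝ 2 h x‖ ^ 2 ≤
      ∑ j, ‖fderiv ℝ (fun y => fderiv ℝ h y (stdOrthonormalBasis ℝ E j)) x‖ ^ 2 := by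
  set b := stdOrthonormalBasis ℝ E with hb
  set m := iteratedFDeriv ℝ 2 h x with hm
  set L : Fin (Module.finrank ℝ E) → (E →L[ℝ] F') :=
    fun j => fderiv ℝ (fun y => fderiv ℝ h y (b j)) x with hL_def
  set S : ℝ := ∑ j, ‖L j‖ ^ 2 with hS
  have hS0 : 0 ≤ S := Finset.sum_nonneg fun j _ => sq_nonneg _
  have hd : DifferentiableAt ℝ (fderiv ℝ h) x :=
    ((hh.fderiv_right (m := 1) le_rfl).differentiable one_ne_zero) x
  have hL : ∀ j (w : E), L j w = fderiv ℝ (fderiv ℝ h) x w (b j) := by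
    intro j w
    simp only [hL_def]
    rw [fderiv_clm_apply hd (differentiableAt_const _)]
    simp
  have key : ‖m‖ ≤ Real.sqrt S := by
    refine ContinuousMultilinearMap.opNorm_le_bound (Real.sqrt_nonneg _) fun v => ?_
    set A : E →L[ℝ] F' := fderiv ℝ (fderiv ℝ h) x (v 0) with hA
    have hmv : m v = A (v 1) := by rw [hm, iteratedFDeriv_two_apply]
    have hAj : ∀ j, ‖A (b j)‖ ≤ ‖L j‖ * ‖v 0‖ := fun j => by
      rw [hA, ← hL j (v 0)]; exact (L j).le_opNorm (v 0)
    have hA_norm : ‖A‖ ≤ ‖v 0‖ * Real.sqrt S := by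
      have h1 : ‖A‖ ^ 2 ≤ frobeniusNormSq A := norm_sq_le_frobeniusNormSq A
      have h2 : frobeniusNormSq A ≤ ‖v 0‖ ^ 2 * S := by
        rw [hS, Finset.mul_sum]
        exact Finset.sum_le_sum fun j _ => by
          calc ‖A (b j)‖ ^ 2 ≤ (‖L j‖ * ‖v 0‖) ^ 2 := pow_le_pow_left₀ (norm_nonneg _) (hAj j) 2
            _ = ‖v 0‖ ^ 2 * ‖L j‖ ^ 2 := by ring
      calc ‖A‖ = Real.sqrt (‖A‖ ^ 2) := (Real.sqrt_sq (norm_nonneg _)).symm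
        _ ≤ Real.sqrt (‖v 0‖ ^ 2 * S) := Real.sqrt_le_sqrt (h1.trans h2)
        _ = ‖v 0‖ * Real.sqrt S := by rw [Real.sqrt_mul (sq_nonneg _), Real.sqrt_sq (norm_nonneg _)]
    calc ‖m v‖ = ‖A (v 1)‖ := by rw [hmv]
      _ ≤ ‖A‖ * ‖v 1‖ := A.le_opNorm _
      _ ≤ ‖v 0‖ * Real.sqrt S * ‖v 1‖ := mul_le_mul_of_nonneg_right hA_norm (norm_nonneg _)
      _ = Real.sqrt S * ∏ i, ‖v i‖ := by rw [Fin.prod_univ_two]; ring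
  calc ‖m‖ ^ 2 ≤ Real.sqrt S ^ 2 := pow_le_pow_left₀ (norm_nonneg _) key 2
    _ = S := Real.sq_sqrt hS0

/-- **`∫ ‖D²h‖² ≤ d² · ‖Dh‖_{L²} ‖D³h‖_{L²}`** (operator norms): for a `C³` field with `Dh, D²h, D³h ∈ L²` —
`wholeSpace_integral_norm_fderiv_sq_le` applied to each partial derivative `∂ⱼh`, summed with
`norm_iteratedFDeriv_two_sq_le_sum`. [cite: AdamsFournier2003, Thm. 5.2 (case m = 3, j = 2, p = 2)] -/
theorem wholeSpace_integral_norm_iteratedFDeriv_two_sq_le {h : E → F'} (hh : ContDiff ℝ 3 h)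
    (h1 : MemLp (fun x => fderiv ℝ h x) 2 volume) (h2 : MemLp (fun x => iteratedFDeriv ℝ 2 h x) 2 volume)
    (h3 : MemLp (fun x => iteratedFDeriv ℝ 3 h x) 2 volume) :
    ∫ x, ‖iteratedFDeriv ℝ 2 h x‖ ^ 2 ≤
      (Module.finrank ℝ E : ℝ) ^ 2 *
        (Real.sqrt (∫ x, ‖fderiv ℝ h x‖ ^ 2) * Real.sqrt (∫ x, ‖iteratedFDeriv ℝ 3 h x‖ ^ 2)) := by
  set d : ℕ := Module.finrank ℝ E with hd
  set b := stdOrthonormalBasis ℝ E with hb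
  have hh2 : ContDiff ℝ 2 h := hh.of_le (by norm_num)
  -- the partial derivatives `hⱼ = ∂ⱼh`
  set g : Fin d → E → F' := fun j y => fderiv ℝ h y (b j) with hg
  have hgc : ∀ j, ContDiff ℝ 2 (g j) := fun j =>
    (hh.fderiv_right (m := 2) (by norm_num)).clm_apply contDiff_const
  have hg0 : ∀ j, MemLp (g j) 2 volume := fun j =>
    memLp_fderiv_apply_of_memLp (hh.of_le (by norm_num)) h1 (b j)
  -- `‖D^i ∂ⱼh‖ ≤ ‖D^{i+1} h‖`
  have hbd : ∀ j (i : ℕ), i ≤ 2 → ∀ x, ‖iteratedFDeriv ℝ i (g j) x‖ ≤ ‖iteratedFDeriv ℝ (i + 1) h x‖ := by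
    intro j i hi x
    have hc : ContDiffAt ℝ 2 (fun y => fderiv ℝ h y) x := (hh.fderiv_right (m := 2) (by norm_num)).contDiffAt
    have := norm_iteratedFDeriv_clm_apply_const (c := b j) hc (by exact_mod_cast hi)
    rw [b.norm_eq_one, one_mul, norm_iteratedFDeriv_fderiv] at this
    exact this
  have hg1 : ∀ j, MemLp (fun x => fderiv ℝ (g j) x) 2 volume := fun j => by
    refine h2.of_le_mul (c := 1) (((hgc j).continuous_fderiv (by norm_num)).aestronglyMeasurable)
      (Eventually.of_forall fun x => ?_)
    rw [one_mul, ← norm_iteratedFDeriv_one]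
    exact hbd j 1 (by norm_num) x
  have hg2 : ∀ j, MemLp (fun x => iteratedFDeriv ℝ 2 (g j) x) 2 volume := fun j => by
    refine h3.of_le_mul (c := 1)
      (((hgc j).continuous_iteratedFDeriv (m := 2) le_rfl).aestronglyMeasurable)
      (Eventually.of_forall fun x => ?_)
    rw [one_mul]
    exact hbd j 2 le_rfl x
  -- integrability
  have hi2 : Integrable (fun x => ‖iteratedFDeriv ℝ 2 h x‖ ^ 2) volume :=
    (memLp_two_iff_integrable_sq_norm h2.1).1 h2
  have hig : ∀ j, Integrable (fun x => ‖fderiv ℝ (g j) x‖ ^ 2) volume := fun j =>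
    (memLp_two_iff_integrable_sq_norm (hg1 j).1).1 (hg1 j)
  -- each term
  set A : ℝ := Real.sqrt (∫ x, ‖fderiv ℝ h x‖ ^ 2) with hA
  set B : ℝ := Real.sqrt (∫ x, ‖iteratedFDeriv ℝ 3 h x‖ ^ 2) with hB
  have hterm : ∀ j, ∫ x, ‖fderiv ℝ (g j) x‖ ^ 2 ≤ d * (A * B) := by
    intro j
    refine (wholeSpace_integral_norm_fderiv_sq_le (hgc j) (hg0 j) (hg1 j) (hg2 j)).trans ?_
    refine mul_le_mul_of_nonneg_left ?_ (by positivity)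
    refine mul_le_mul (Real.sqrt_le_sqrt ?_) (Real.sqrt_le_sqrt ?_) (Real.sqrt_nonneg _)
      (Real.sqrt_nonneg _)
    · exact integral_mono_of_nonneg (Eventually.of_forall fun x => sq_nonneg _)
        ((memLp_two_iff_integrable_sq_norm h1.1).1 h1)
        (Eventually.of_forall fun x => by
          have := (fderiv ℝ h x).le_opNorm (b j)
          rw [b.norm_eq_one, mul_one] at this
          exact pow_le_pow_left₀ (norm_nonneg _) this 2)
    · exact integral_mono_of_nonneg (Eventually.of_forall fun x => sq_nonneg _)
        ((memLp_two_iff_integrable_sq_norm h3.1).1 h3)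
        (Eventually.of_forall fun x => pow_le_pow_left₀ (norm_nonneg _) (hbd j 2 le_rfl x) 2)
  -- sum
  calc ∫ x, ‖iteratedFDeriv ℝ 2 h x‖ ^ 2 ≤ ∫ x, ∑ j, ‖fderiv ℝ (g j) x‖ ^ 2 :=
        integral_mono hi2 (integrable_finsetSum _ fun j _ => hig j)
          fun x => norm_iteratedFDeriv_two_sq_le_sum hh2 x
    _ = ∑ j, ∫ x, ‖fderiv ℝ (g j) x‖ ^ 2 := integral_finsetSum _ fun j _ => hig j
    _ ≤ ∑ _j : Fin d, (d : ℝ) * (A * B) := Finset.sum_le_sum fun j _ => hterm j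
    _ = (d : ℝ) ^ 2 * (A * B) := by
        simp [Finset.sum_const, Finset.card_univ, Fintype.card_fin]; ring

end Literature.Analysis.FluidPDE

end
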